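import Summits.CriticalPhenomena.CardyFormulaZ2.Theorems.CardyBoundaryCoulombGasBoundaryDefectGaussianRStubGreenKernelAsymptoticsPart4
import Mathlib.Analysis.Calculus.Deriv.Basic
import Mathlib.Analysis.Convex.Segment
import Literature.Probability.LatticeModels.CollarLegModel
import Literature.Probability.LatticeModels.DirichletGreenFunction
import Literature.Probability.LatticeModels.DomainDiscretisation
import Literature.Probability.LatticeModels.LatticeGraph
import Literature.Probability.RandomPlanarGeometry.PlanarDomains
import Literature.Probability.LatticeModels.FlatBoundaryPoissonKernelLimit

/-!
# Stub `stub_greenKernelAsymptotics` of line `rainbow-monomials-in-excursion-kernels` — Part 5: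
# the stub's statement from two cited facts of discrete potential theory
# (crux `BoundaryDefectGaussianR`, stmt-CriticalPhenomena-14132)

Part 4 (`greenKernelAsymptotics_of_limits`) reduced the registered statement
`G_{V_n}(a_n,b_n)/δ_n² → (1/π)|w′(x)||w′(y)|/|w(x)−w(y)|²` to two boundary–interior limits at an
auxiliary interior point `u ∈ D`, `c_n → u`. Those two limits are published theorems of
discrete potential theory which the tree does not prove; following CONVENTIONS §4 they are
stated here as NAMED FACTS, specialised to `ℤ²` and to the lattice approximations
`V_n = {v : δ_n v ∈ D̄}` of rectilinear Jordan domains used by the stubs (the tree has no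
Temperleyan-polyomino / isoradial-discrete-domain / Carathéodory-convergence vocabulary in which
the general forms are printed):

* `Kenyon2000_flatEdgePoissonKernelLimit` — Kenyon 2000, Cor. 19 (with Lemma 17): the Green
  function with one argument on the lattice row of a flat boundary edge, divided by the mesh,
  converges to the Poisson kernel: `G_{V_n}(c_n,a_n)/δ_n → (1/π) Im w(u)|w′(x)|/|w(u)−w(x)|²`;
* `ChelkakSmirnov2011_boundaryNormalisedPoissonKernelLimit` — Chelkak–Smirnov 2011, Thm. 3.13:
  the discrete Poisson kernel with boundary pole, normalised at a straight boundary point,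
  converges to the continuum Poisson kernel normalised by inner normal derivative `1` there:
  `G_{V_n}(c_n,b_n)δ_n/G_{V_n}(a_n,b_n) → [Im w(u)/|w(u)−w(y)|²]·[|w(x)−w(y)|²/|w′(x)|]`.

`greenKernelAsymptotics_of_facts` then proves the statement of `stub_greenKernelAsymptotics`
VERBATIM (with `c = 1/π`) from the two facts: pick `u ∈ D` and lattice points `c_n ∈ V_n` with
`δ_n c_n → u` (`green_interiorLatticePoints`, registered sub-goal `s11_interiorLatticePoints`),
transcribe the stubs' `ℤ × ℤ` data to `Site 2` (Part 4), apply the facts and Part 4. The stub is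
thereby CLOSED MODULO the two named facts (a conditional result; the stub itself stays open
until the facts are discharged).
-/

noncomputable section

open Filter Topology Set Metric
open Literature.Probability.RandomPlanarGeometry Literature.Probability.LatticeModels

namespace Summit.CriticalPhenomena.CardyFormulaZ2.Cruxes.BoundaryDefectGaussianR.RainbowMonomialsInExcursionKernels

/-! ### The two cited facts (named facts; relocated to Literature by the gate) -/

/-- **Lattice points of `V_n` converging to an interior point.** For a Jordan domain `D`, meshes
`δ_n → 0⁺`, the lattice approximations `V_n = {v : δ_n v ∈ D̄}` and any `a_n ∈ V_n`: every
`u ∈ D` is the limit of mesh points of some `c_n ∈ V_n` (the nearest site to `u` as soon as its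
mesh point lies in `D`, which happens eventually; `a_n` before). [folklore] -/
theorem green_interiorLatticePoints (D : JordanDomain) {δ : ℕ → ℝ} (hδ : ∀ n, 0 < δ n)
    (hδ0 : Tendsto δ atTop (𝓝 0)) {V : ℕ → Finset (Site 2)}
    (hV : ∀ n v, v ∈ V n ↔ meshPoint (δ n) v ∈ closure D.carrier) {a : ℕ → Site 2}
    (ha : ∀ n, a n ∈ V n) {u : ℂ} (hu : u ∈ D.carrier) :
    ∃ c : ℕ → Site 2, (∀ n, c n ∈ V n) ∧ Tendsto (fun n => meshPoint (δ n) (c n)) atTop (𝓝 u) := by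
  classical
  set p : ℕ → Site 2 := fun n => nearestSite (δ n) u with hp_def
  have hp : Tendsto (fun n => meshPoint (δ n) (p n)) atTop (𝓝 u) := by
    rw [tendsto_iff_dist_tendsto_zero]
    exact squeeze_zero (fun n => dist_nonneg) (fun n => dist_meshPoint_nearestSite_le (hδ n) u) hδ0
  have hpV : ∀ᶠ n in atTop, p n ∈ V n := by
    have h1 : ∀ᶠ n in atTop, meshPoint (δ n) (p n) ∈ D.carrier := hp (D.isOpen.mem_nhds hu)
    exact h1.mono fun n hn => (hV n _).2 (subset_closure hn)
  refine ⟨fun n => if p n ∈ V n then p n else a n, fun n => ?_, ?_⟩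
  · by_cases h : p n ∈ V n
    · simp only [h, if_true]
    · simp only [h, if_false]; exact ha n
  · exact hp.congr' (hpV.mono fun n hn => by simp only [hn, if_true])

/-- **Registered sub-goal `s11_interiorLatticePoints` of stub 5** (stmt-CriticalPhenomena-14132):
the auxiliary interior evaluation points of the reduction exist — every interior point of a
Jordan domain is a limit of mesh points of lattice points of `V_n = {v : δ_n v ∈ D̄}`
(`green_interiorLatticePoints`). [folklore] -/
theorem s11_interiorLatticePoints : ∀ (D : Literature.Probability.RandomPlanarGeometry.JordanDomain) (δ : ℕ → ℝ), (∀ n, 0 < δ n) → Filter.Tendsto δ Filter.atTop (nhds 0) → ∀ (V : ℕ → Finset (Literature.Probability.LatticeModels.Site 2)), (∀ n v, v ∈ V n ↔ Literature.Probability.LatticeModels.meshPoint (δ n) v ∈ closure D.carrier) → ∀ (a : ℕ → Literature.Probability.LatticeModels.Site 2), (∀ n, a n ∈ V n) → ∀ u ∈ D.carrier, ∃ c : ℕ → Literature.Probability.LatticeModels.Site 2, (∀ n, c n ∈ V n) ∧ Filter.Tendsto (fun n => Literature.Probability.LatticeModels.meshPoint (δ n) (c n)) Filter.atTop (nhds u)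 :=
  fun D _ hδ hδ0 _ hV _ ha _ hu => green_interiorLatticePoints D hδ hδ0 hV ha hu

/-! ### The stub's statement, verbatim, from the two facts -/

/-- **`stub_greenKernelAsymptotics` from the two cited facts** (its registered statement verbatim,
with the universal constant `c = 1/π` in the tree's normalisation `G = (4 − A)⁻¹`): CONDITIONAL
on `Kenyon2000_flatEdgePoissonKernelLimit` and
`ChelkakSmirnov2011_boundaryNormalisedPoissonKernelLimit`. Proof: transcribe the `ℤ × ℤ` data to
`Site 2` (Part 4), choose interior evaluation points (`green_interiorLatticePoints`), apply the
facts at `y` resp. `(x, y)` and conclude by `greenKernelAsymptotics_of_limits` (Part 4).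
[folklore] -/
theorem greenKernelAsymptotics_of_facts (hA : Literature.Probability.LatticeModels.Kenyon2000_flatEdgePoissonKernelLimit)
    (hB : Literature.Probability.LatticeModels.ChelkakSmirnov2011_boundaryNormalisedPoissonKernelLimit) :
    ∃ c : ℝ, 0 < c ∧ ∀ (D : Literature.Probability.RandomPlanarGeometry.JordanDomain), (∃ S : Finset (ℂ × ℂ), (∀
    q ∈ S, q.1.re = q.2.re ∨ q.1.im = q.2.im) ∧ frontier D.carrier ⊆ ⋃ q ∈ S, segment ℝ q.1 q.2) → ∀ (x y : ℂ),
    x ∈ frontier D.carrier → y ∈ frontier D.carrier → x ≠ y → (∃ r : ℝ, 0 < r ∧ ((∀ z ∈ frontier D.carrier, dist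
    z (x) < r → z.im = (x).im) ∨ (∀ z ∈ frontier D.carrier, dist z (x) < r → z.re = (x).re))) → (∃ r : ℝ, 0 < r
    ∧ ((∀ z ∈ frontier D.carrier, dist z (y) < r → z.im = (y).im) ∨ (∀ z ∈ frontier D.carrier, dist z (y) < r →
    z.re = (y).re))) → ∀ (w : ℂ → ℂ) (U : Set ℂ), IsOpen U → D.carrier ⊆ U → x ∈ U → y ∈ U → DifferentiableOn ℂ
    w U → Set.BijOn w D.carrier {z : ℂ | 0 < z.im} → ∀ (δ : ℕ → ℝ), (∀ n, 0 < δ n) → Filter.Tendsto δ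
    Filter.atTop (nhds 0) → ∀ (V : ℕ → Finset (ℤ × ℤ)), (∀ n, ∀ v : ℤ × ℤ, v ∈ V n ↔ (((v).1 : ℂ) * ((δ n : ℝ) :
    ℂ) + ((v).2 : ℂ) * ((δ n : ℝ) : ℂ) * Complex.I) ∈ closure D.carrier) → ∀ (a b : ℕ → ℤ × ℤ), (∀ n, a n ∈ V n
    ∧ ((Literature.Probability.LatticeModels.CollarLegModel.neighbours (a n)).filter (fun u ↦ u ∉ V n)).card =
    1) → (∀ n, b n ∈ V n ∧ ((Literature.Probability.LatticeModels.CollarLegModel.neighbours (b n)).filter (fun u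
    ↦ u ∉ V n)).card = 1) → Filter.Tendsto (fun n ↦ (((a n).1 : ℂ) * ((δ n : ℝ) : ℂ) + ((a n).2 : ℂ) * ((δ n :
    ℝ) : ℂ) * Complex.I)) Filter.atTop (nhds x) → Filter.Tendsto (fun n ↦ (((b n).1 : ℂ) * ((δ n : ℝ) : ℂ) + ((b
    n).2 : ℂ) * ((δ n : ℝ) : ℂ) * Complex.I)) Filter.atTop (nhds y) → Filter.Tendsto (fun n ↦
    (Literature.Probability.LatticeModels.dirichletGreen ((V n).image (fun v : ℤ × ℤ ↦ (![v.1, v.2] : Fin 2 →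
    ℤ))) (![(a n).1, (a n).2] : Fin 2 → ℤ) (![(b n).1, (b n).2] : Fin 2 → ℤ)) / (δ n) ^ 2) Filter.atTop (nhds (c
    * (‖deriv w x‖ * ‖deriv w y‖ / ‖w x - w y‖ ^ 2))) := by
  refine ⟨1 / Real.pi, by positivity, ?_⟩
  intro D hS x y hx hy hxy hflx hfly w U hU hDU hxU hyU hw hbij δ hδ hδ0 V hV a b ha hb hax hby
  -- transcription of the data to `Site 2`
  have hV' : ∀ n (v' : Site 2), v' ∈ (V n).image (fun p : ℤ × ℤ => (![p.1, p.2] : Site 2)) ↔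
      meshPoint (δ n) v' ∈ closure D.carrier := by
    intro n v'
    rw [green_mem_image_toSite, hV n, ← green_meshPoint_toSite]
    congr! 2
    ext i; fin_cases i <;> rfl
  have ha' : ∀ n, (![(a n).1, (a n).2] : Site 2) ∈ (V n).image (fun p : ℤ × ℤ => (![p.1, p.2] : Site 2)) ∧
      (((zdGraph 2).neighborFinset (![(a n).1, (a n).2] : Site 2)).filter
        (fun u => u ∉ (V n).image (fun p : ℤ × ℤ => (![p.1, p.2] : Site 2)))).card = 1 :=
    fun n => ⟨(green_toSite_injective.mem_finset_image).2 (ha n).1,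
      by rw [green_card_filter_toSite]; exact (ha n).2⟩
  have hb' : ∀ n, (![(b n).1, (b n).2] : Site 2) ∈ (V n).image (fun p : ℤ × ℤ => (![p.1, p.2] : Site 2)) ∧
      (((zdGraph 2).neighborFinset (![(b n).1, (b n).2] : Site 2)).filter
        (fun u => u ∉ (V n).image (fun p : ℤ × ℤ => (![p.1, p.2] : Site 2)))).card = 1 :=
    fun n => ⟨(green_toSite_injective.mem_finset_image).2 (hb n).1,
      by rw [green_card_filter_toSite]; exact (hb n).2⟩
  have hax' : Tendsto (fun n => meshPoint (δ n) (![(a n).1, (a n).2] : Site 2)) atTop (𝓝 x) := by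
    simpa only [green_meshPoint_toSite] using hax
  have hby' : Tendsto (fun n => meshPoint (δ n) (![(b n).1, (b n).2] : Site 2)) atTop (𝓝 y) := by
    simpa only [green_meshPoint_toSite] using hby
  -- interior evaluation points
  obtain ⟨u, hu⟩ := D.nonempty
  obtain ⟨c, hc, hcu⟩ := green_interiorLatticePoints D hδ hδ0 hV' (fun n => (ha' n).1) hu
  -- the two facts and Part 4
  exact greenKernelAsymptotics_of_limits D hx hy hxy hflx hfly hU hDU hxU hyU hw hbij hδ hu
    (hA D hS y hy hfly w U hU hDU hyU hw hbij δ hδ hδ0 _ hV' _ hb' hby' u hu c hc hcu)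
    (hB D hS x y hx hy hxy hflx hfly w U hU hDU hxU hyU hw hbij δ hδ hδ0 _ hV' _ _ ha' hb' hax' hby'
      u hu c hc hcu)

end Summit.CriticalPhenomena.CardyFormulaZ2.Cruxes.BoundaryDefectGaussianR.RainbowMonomialsInExcursionKernels

end
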